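import Summits.QuantumAdvantage.QuantumAdvantage.Theorems.NearExactIsExact.Negative.RMDual
import Summits.QuantumAdvantage.QuantumAdvantage.Theorems.NearExactIsExact.Negative.ProductTest

/-!
# `NearExactIsExact` (stmt-QuantumAdvantage-14043) — negative-side tool: the INVERSE of a low-degree permutation

Disprover seat `b2b-cforr-disprove-g30` (2026-08-22).  A classical fact about permutations of the cube, kernel-checked
because the habitat census of DISPROOF §38 needs it:

* `inverse_isDegLeFun` — for mutually inverse maps `σ, τ : 𝔽₂^m → 𝔽₂^m`, if every coordinate of `σ` has degree
  `≤ d` with `d + 2 ≤ m`, then every coordinate of `τ = σ⁻¹` has degree `≤ m − 2`.  (Equivalently: `deg σ⁻¹ = m − 1`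
  iff `deg σ = m − 1`.)  Proof: by Reed–Muller duality (`RMDual.isDegLeFun_of_orthogonal` with `d = 1`,
  `k = m − 2`) it suffices that `#{y : p(y) ∧ τ(y)_i}` is even for every affine `p`; pulled back along the bijection
  `σ` this is `#{x : p(σ x) ∧ x_i}`, the weight of a Boolean function of degree `≤ d + 1 < m`
  (`fc_isDegLeFun_comp`, `te_isDegLeFun_band`), hence even (`ProductTest.even_card_of_deg_lt`).
* `inverse_quadratic_four` — the case `m = 4`, `d = 2`: EVERY coordinatewise-quadratic permutation of `𝔽₂⁴` has a
  coordinatewise-quadratic inverse.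

USE (DISPROOF §38.12).  A member `G(x′,y,z) = x′·σ(y) ⊕ h_y(z)` of the habitat `H(4,6;14)` has `σ` a permutation of
`𝔽₂⁴` with quadratic coordinates (forced by `deg G ≤ 3`); by `inverse_quadratic_four` its inverse `τ` is quadratic
too, so for EVERY cubic partner `f` the twisted partner `f ⊕ b·τ(a)` is cubic and the shape lemma
(`Negative.ShapeLemma.shape_of_defect_lt`, threshold `8·D < 2^n`) applies: the residual case "`τ` has a cubic
coordinate" of §38.12(b) is EMPTY, and the exact-shape dichotomy of §38.12(a) covers the whole habitat.  (For fibre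
dimension `s ≥ 5` this fails — quadratic permutations of `𝔽₂ˢ` may have inverses of degree up to `s − 2 ≥ 3` — so
`s = 4` is exactly the case where the relabelling is automatically bi-quadratic.)  Cross-check by exhaustive
enumeration: `code/disprove-g30/pc46/qperm/qperm_all.c` lists all `82 555 200 · 16` quadratic permutations of `𝔽₂⁴`;
every inverse is quadratic.

HONEST FRAMING: a kernel-checked NEGATIVE-SIDE TOOL for the census of one habitat of the crux
`Summit.QuantumAdvantage.QuantumAdvantage.Theses.CubicForrelation.NearExactIsExact`; it does not decide the crux and is
NOT summit progress.  Sources: C. Boura, A. Canteaut, IEEE Trans. Inform. Theory 59 (2013) 691–702, §III-C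
Cor. 3.3 and the remark after it ("deg(F⁻¹) = n − 1 if and only if deg(F) = n − 1", p. 5); F. J. MacWilliams, N. J. A. Sloane, The Theory of Error-Correcting Codes (1977)
Ch. 13 §§3–4.  Everything is proved here from the tree; standard axioms only.
-/

set_option linter.dupNamespace false -- D-0017: single-problem summit ⇒ `QuantumAdvantage.QuantumAdvantage` by design

namespace Summit.QuantumAdvantage.QuantumAdvantage.Theorems.NearExactIsExact.Negative.InverseDegree

open Finset
open Literature.Computability.QuantumComplexity
open Summit.QuantumAdvantage.QuantumAdvantage.Theorems.CubicForrelation.NearExactIsExact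
  (fc_isDegLeFun_comp te_isDegLeFun_band)
open Summit.QuantumAdvantage.QuantumAdvantage.Theorems.NearExactIsExact.Negative.BqqSeven (bq_card_filter_comp)
open Summit.QuantumAdvantage.QuantumAdvantage.Theorems.NearExactIsExact.Negative.ProductTest (even_card_of_deg_lt)
open Summit.QuantumAdvantage.QuantumAdvantage.Theorems.NearExactIsExact.Negative.RMDual (isDegLeFun_of_orthogonal)

variable {m : ℕ}

/-- A map of the cube with a two-sided inverse is a bijection. [folklore] -/
theorem bijective_of_inverse (σ τ : (Fin m → Bool) → (Fin m → Bool)) (hτσ : ∀ x, τ (σ x) = x)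
    (hστ : ∀ y, σ (τ y) = y) : Function.Bijective σ :=
  ⟨fun a b hab => by rw [← hτσ a, ← hτσ b, hab], fun y => ⟨τ y, hστ y⟩⟩

/-- Pulling a count back along a bijection `σ` of the cube: `#{y : G y} = #{x : G (σ x)}`. [folklore] -/
theorem card_filter_comp_eq (σ τ : (Fin m → Bool) → (Fin m → Bool)) (hτσ : ∀ x, τ (σ x) = x)
    (hστ : ∀ y, σ (τ y) = y) (G : (Fin m → Bool) → Bool) :
    #(univ.filter fun y : Fin m → Bool => G y = true) = #(univ.filter fun x : Fin m → Bool => G (σ x) = true) :=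
  (bq_card_filter_comp σ (bijective_of_inverse σ τ hτσ hστ) G).symm

/-- **The inverse of a low-degree permutation has degree `≤ m − 2`.**  For mutually inverse maps `σ, τ` of `𝔽₂^m`
whose coordinates `x ↦ σ(x)_j` all have degree `≤ d`, `d + 2 ≤ m`: every coordinate `y ↦ τ(y)_i` has degree
`≤ m − 2` (so `deg σ⁻¹ = m − 1` iff `deg σ = m − 1`).
[cite: BouraCanteaut2013, §III-C, Cor. 3.3 and the remark after it (p. 5): `deg F⁻¹ = n − 1 ⟺ deg F = n − 1`] -/
theorem inverse_isDegLeFun {d : ℕ} (σ τ : (Fin m → Bool) → (Fin m → Bool))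
    (hτσ : ∀ x, τ (σ x) = x) (hστ : ∀ y, σ (τ y) = y)
    (hσ : ∀ j, IsDegLeFun d (fun x => σ x j)) (hd : d + 2 ≤ m) (i : Fin m) :
    IsDegLeFun (m - 2) (fun y => τ y i) := by
  refine isDegLeFun_of_orthogonal (d := 1) (by omega) fun p hp => ?_
  -- pull the count back along `σ`: `#{y : p y ∧ τ(y)_i} = #{x : p (σ x) ∧ x_i}`
  have hc : #(univ.filter fun y : Fin m → Bool => (p y && τ y i) = true) =
      #(univ.filter fun x : Fin m → Bool => (p (σ x) && x i) = true) := by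
    rw [card_filter_comp_eq σ τ hτσ hστ (fun y => p y && τ y i)]
    simp_rw [hτσ]
  -- `x ↦ p(σ x) ∧ x_i` has degree `≤ d + 1 < m`, hence even weight
  have hdeg : IsDegLeFun (d + 1) (fun x : Fin m → Bool => p (σ x) && x i) :=
    te_isDegLeFun_band (fc_isDegLeFun_comp hp σ hσ (by omega)) (isDegLeFun_apply i le_rfl)
  have hev := even_card_of_deg_lt hdeg (by omega)
  rw [← hc] at hev
  exact hev

/-- **Every coordinatewise-quadratic permutation of `𝔽₂⁴` has a coordinatewise-quadratic inverse**
(`m = 4`, `d = 2` in `inverse_isDegLeFun`).  In the habitat `H(4,6;14)` of DISPROOF §38 this makes the partner twist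
`f ⊕ b·σ⁻¹(a)` cubic for every cubic `f`, so the shape lemma applies to every member.
[cite: BouraCanteaut2013, §III-C, Cor. 3.3 (p. 5)] -/
theorem inverse_quadratic_four (σ τ : (Fin 4 → Bool) → (Fin 4 → Bool))
    (hτσ : ∀ x, τ (σ x) = x) (hστ : ∀ y, σ (τ y) = y) (hσ : ∀ j, IsDegLeFun 2 (fun x => σ x j))
    (i : Fin 4) : IsDegLeFun 2 (fun y => τ y i) :=
  inverse_isDegLeFun σ τ hτσ hστ hσ (by norm_num) i

/-- The same fact read in the other direction: if some coordinate of `σ⁻¹` fails to have degree `≤ m − 2`, then some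
coordinate of `σ` fails to have degree `≤ m − 2` (`2 ≤ m`). [folklore] -/
theorem exists_coord_not_isDegLeFun_of_inverse (σ τ : (Fin m → Bool) → (Fin m → Bool))
    (hτσ : ∀ x, τ (σ x) = x) (hστ : ∀ y, σ (τ y) = y) (hm : 2 ≤ m)
    (h : ∃ i, ¬ IsDegLeFun (m - 2) (fun y => τ y i)) : ∃ j, ¬ IsDegLeFun (m - 2) (fun x => σ x j) := by
  obtain ⟨i, hi⟩ := h
  by_contra hne
  exact hi (inverse_isDegLeFun σ τ hτσ hστ (fun j => not_not.mp (not_exists.mp hne j)) (by omega) i)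

end Summit.QuantumAdvantage.QuantumAdvantage.Theorems.NearExactIsExact.Negative.InverseDegree
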